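import Mathlib.Analysis.SpecialFunctions.Log.Deriv
import Mathlib.Analysis.SpecialFunctions.Sqrt
import Mathlib.Analysis.SpecialFunctions.Pow.Real
import Mathlib.MeasureTheory.Integral.IntervalIntegral.IntegrationByParts
import Mathlib.MeasureTheory.Integral.IntervalIntegral.FundThmCalculus
import Mathlib.Analysis.Calculus.Deriv.Inv
import HarnessLib

/-!
# Crux `BlockLipschitzL` (stmt-QuantumFields-23533) ∕ `HistoryTailL` (stmt-QuantumFields-19936), LINE 25 «CompactnessTransfer»,
# stub S1″ — the (TM) road, file TM-F2a «THE LOGARITHMIC HARDY PROFILES»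

Cell `ym3-torus` (YM ladder rung R3 = continuum SU(2) Yang–Mills on T³ — a RUNG, NOT Clay: not d = 4, not infinite volume,
not a mass gap); WIDTH helper seat `ym3-torus-px3` g9 (LEAD ★w1-19936 g10 «GO (i)» 15:27:31Z); `--supports
stmt-QuantumFields-23533`; THEOREMS ONLY (0 `def`, 0 `sorry`, default heartbeats); Mathlib only.

WHAT THIS FILE DOES — the one-dimensional half of the density cap `Θ ≤ 3π` (TM-F2b): the SHARPNESS of Hardy's constant `¼`
in `∫₀^∞ F² ≤ 4∫₀^∞ r²F′²`, made EXACT and limit-free.  For a bump `Ψ ∈ C^∞(ℝ)` vanishing with its derivative off `(−2,−1)`,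
a scale `L > 0` and a centre `c`, the LOGARITHMIC PROFILE `F(r) := Ψ((log r − c)∕L)·(√r)⁻¹` (`= 0` for `r ≤ 0` and off
`[e^{c−2L}, e^{c−L}]`) satisfies, on any `[0, ρ]` with `e^{c−L} ≤ ρ`:
* ★★ `integral_logProfile_sq` — `∫₀^ρ F² = L · ∫_{−2}^{−1} Ψ²`;
* ★★ `integral_sq_mul_deriv_logProfile_sq` — `∫₀^ρ r²·F′² = L · ∫_{−2}^{−1} (Ψ′∕L − Ψ∕2)²`, and
  ★ `integral_profile_quadratic` — `∫_{−2}^{−1} (Ψ′∕L − Ψ∕2)² = (∫Ψ′²)∕L² + (∫Ψ²)∕4` (the cross term `∫ΨΨ′ = 0`);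
  so `∫₀^ρ r²F′² = ¼·∫₀^ρ F² + (∫Ψ′²)∕L` — the Hardy deficit is `O(1∕L)` against `∫F² = Θ(L)`;
* letters: `logProfile_eq_zero_of_le` ∕ `_of_ge` (the zero set), `contDiffAt_logProfile` (`C^∞` at `r > 0`),
  ★ `hasDerivAt_logProfile` (`F′(r) = (√r)⁻¹·r⁻¹·(Ψ′(φ)∕L − Ψ(φ)∕2)`, `φ = (log r − c)∕L`).
The substitution is `r = e^{c + Lu}` (`intervalIntegral.integral_comp_mul_deriv'`).
HONEST SCOPE.  Calculus letters; nothing of (TM), (ZD), (C), S1″, K1, `MeanDeviationL`, `BlockLipschitzL`, `HistoryTailL` is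
proved here.  YM₃ on T³ is rung R3, not Clay; YM gap NOT proved; no summit statement is proved here.

References: R. Schoen, K. Uhlenbeck, Invent. Math. 78 (1984) [SchoenUhlenbeck1984] (Lemma 1.3: the Hardy-type infimum `¼`);
G. H. Hardy, J. E. Littlewood, G. Pólya, Inequalities (1934) [HardyLittlewoodPolya1934] (Thm. 327 and its sharpness).
-/

set_option autoImplicit false

noncomputable section

open scoped BigOperators Topology ContDiff
open MeasureTheory Set Filter Function intervalIntegral

namespace Summit.QuantumFields.YangMills.Theorems.PoincareLipschitzHardyLogProfile

variable {Ψ : ℝ → ℝ} {c L : ℝ}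

/-! ## §1 The zero set and smoothness of the logarithmic profile -/

/-- The profile vanishes for `r ≤ e^{c − 2L}` (in particular for `r ≤ 0`, where `(√r)⁻¹ = 0`). [folklore] -/
theorem logProfile_eq_zero_of_le (hΨ0 : ∀ u : ℝ, u ≤ -2 ∨ -1 ≤ u → Ψ u = 0) (hL : 0 < L) {r : ℝ}
    (hr : r ≤ Real.exp (c - 2 * L)) :
    Ψ ((Real.log r - c) / L) * (Real.sqrt r)⁻¹ = 0 := by
  by_cases hr0 : r ≤ 0
  · rw [Real.sqrt_eq_zero'.2 hr0, inv_zero, mul_zero]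
  · push Not at hr0
    have hlog : Real.log r ≤ c - 2 * L := by
      rw [← Real.log_exp (c - 2 * L)]; exact Real.log_le_log hr0 hr
    have : (Real.log r - c) / L ≤ -2 := by rw [div_le_iff₀ hL]; linarith
    rw [hΨ0 _ (Or.inl this), zero_mul]

/-- The profile vanishes for `r ≥ e^{c − L}`. [folklore] -/
theorem logProfile_eq_zero_of_ge (hΨ0 : ∀ u : ℝ, u ≤ -2 ∨ -1 ≤ u → Ψ u = 0) (hL : 0 < L) {r : ℝ}
    (hr : Real.exp (c - L) ≤ r) :
    Ψ ((Real.log r - c) / L) * (Real.sqrt r)⁻¹ = 0 := by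
  have hr0 : 0 < r := lt_of_lt_of_le (Real.exp_pos _) hr
  have hlog : c - L ≤ Real.log r := by
    rw [← Real.log_exp (c - L)]; exact Real.log_le_log (Real.exp_pos _) hr
  have : -1 ≤ (Real.log r - c) / L := by rw [le_div_iff₀ hL]; linarith
  rw [hΨ0 _ (Or.inr this), zero_mul]

/-- The profile is `C^∞` at every `r > 0`. [folklore] -/
theorem contDiffAt_logProfile (hΨ : ContDiff ℝ ∞ Ψ) (c L : ℝ) {r : ℝ} (hr : 0 < r) :
    ContDiffAt ℝ ∞ (fun r : ℝ => Ψ ((Real.log r - c) / L) * (Real.sqrt r)⁻¹) r := by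
  have h1 : ContDiffAt ℝ ∞ (fun r : ℝ => (Real.log r - c) / L) r :=
    ((Real.contDiffAt_log.2 hr.ne').sub contDiffAt_const).div_const L
  have h2 : ContDiffAt ℝ ∞ (fun r : ℝ => Ψ ((Real.log r - c) / L)) r := hΨ.contDiffAt.comp r h1
  have h3 : ContDiffAt ℝ ∞ (fun r : ℝ => (Real.sqrt r)⁻¹) r :=
    (Real.contDiffAt_sqrt hr.ne').inv (Real.sqrt_ne_zero'.2 hr)
  exact h2.mul h3

/-- ★ **THE DERIVATIVE OF THE LOGARITHMIC PROFILE** at `r > 0`: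
`F′(r) = (√r)⁻¹·r⁻¹·(Ψ′(φ(r))∕L − Ψ(φ(r))∕2)`, `φ(r) = (log r − c)∕L`. [folklore] -/
theorem hasDerivAt_logProfile (hΨ : ContDiff ℝ ∞ Ψ) (c : ℝ) {L : ℝ} (hL : L ≠ 0) {r : ℝ} (hr : 0 < r) :
    HasDerivAt (fun r : ℝ => Ψ ((Real.log r - c) / L) * (Real.sqrt r)⁻¹)
      ((Real.sqrt r)⁻¹ * r⁻¹ * (deriv Ψ ((Real.log r - c) / L) / L - Ψ ((Real.log r - c) / L) / 2)) r := by
  have hΨd : Differentiable ℝ Ψ := hΨ.differentiable (by simp)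
  have hsq : Real.sqrt r ≠ 0 := Real.sqrt_ne_zero'.2 hr
  -- `φ`
  have hφ : HasDerivAt (fun r : ℝ => (Real.log r - c) / L) (r⁻¹ / L) r := by
    have := ((Real.hasDerivAt_log hr.ne').sub_const c).div_const L
    simpa using this
  -- `Ψ ∘ φ`
  have hA : HasDerivAt (fun r : ℝ => Ψ ((Real.log r - c) / L)) (deriv Ψ ((Real.log r - c) / L) * (r⁻¹ / L)) r :=
    (hΨd _).hasDerivAt.comp r hφ
  -- `(√r)⁻¹`
  have hB : HasDerivAt (fun r : ℝ => (Real.sqrt r)⁻¹) (-(1 / (2 * Real.sqrt r)) / Real.sqrt r ^ 2) r :=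
    (Real.hasDerivAt_sqrt hr.ne').inv hsq
  have h := hA.mul hB
  refine h.congr_deriv ?_
  have hsq2 : Real.sqrt r ^ 2 = r := Real.sq_sqrt hr.le
  field_simp
  rw [hsq2]
  ring

/-! ## §2 The two interval integrals by the substitution `r = e^{c + Lu}` -/

/-- The substitution `r = e^{c+Lu}`: for `G` continuous, `∫_{e^{c−2L}}^{e^{c−L}} r⁻¹·G((log r − c)∕L) dr = L·∫_{−2}^{−1} G`. [folklore] -/
theorem integral_inv_mul_comp_log (hL : 0 < L) {G : ℝ → ℝ} (hG : Continuous G) :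
    ∫ r in Real.exp (c - 2 * L)..Real.exp (c - L), r⁻¹ * G ((Real.log r - c) / L) = L * ∫ u in (-2:ℝ)..(-1), G u := by
  -- `g(u) = e^{c + L u}`, `g′ = L·g`
  have hg : ∀ u ∈ uIcc (-2:ℝ) (-1), HasDerivAt (fun u : ℝ => Real.exp (c + L * u)) (L * Real.exp (c + L * u)) u := by
    intro u _
    have h1 : HasDerivAt (fun u : ℝ => c + L * u) L u := by
      simpa using ((hasDerivAt_id u).const_mul L).const_add c
    have := h1.exp
    simpa [mul_comm] using this
  have hg' : ContinuousOn (fun u : ℝ => L * Real.exp (c + L * u)) (uIcc (-2:ℝ) (-1)) := by fun_prop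
  have hh : ContinuousOn (fun r : ℝ => r⁻¹ * G ((Real.log r - c) / L))
      ((fun u : ℝ => Real.exp (c + L * u)) '' uIcc (-2:ℝ) (-1)) := by
    refine ContinuousOn.mono ?_ (show (fun u : ℝ => Real.exp (c + L * u)) '' uIcc (-2:ℝ) (-1) ⊆ Ioi 0 from ?_)
    · intro r hr
      have hr0 : r ≠ 0 := (mem_Ioi.1 hr).ne'
      exact ((continuousAt_inv₀ hr0).mul
        ((hG.continuousAt).comp (((Real.continuousAt_log hr0).sub continuousAt_const).div_const L))).continuousWithinAt
    · rintro _ ⟨u, _, rfl⟩; exact Real.exp_pos _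
  have key := intervalIntegral.integral_comp_mul_deriv' hg hg' hh
  have hφ : ∀ u : ℝ, (Real.log (Real.exp (c + L * u)) - c) / L = u := fun u => by
    rw [Real.log_exp]; field_simp; ring
  have hends1 : Real.exp (c + L * (-2)) = Real.exp (c - 2 * L) := by ring_nf
  have hends2 : Real.exp (c + L * (-1)) = Real.exp (c - L) := by ring_nf
  rw [hends1, hends2] at key
  rw [← key]
  have : ∀ u : ℝ, ((fun r : ℝ => r⁻¹ * G ((Real.log r - c) / L)) ∘ fun u : ℝ => Real.exp (c + L * u)) u * (L * Real.exp (c + L * u))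
      = L * G u := by
    intro u
    simp only [Function.comp_apply, hφ u]
    have hne : Real.exp (c + L * u) ≠ 0 := (Real.exp_pos _).ne'
    field_simp
  simp_rw [this, intervalIntegral.integral_const_mul]

/-- An interval integral over `[0, ρ]` of a function vanishing on `[0, a]` and on `[b, ρ]` and continuous on `(0, ∞)` reduces to
`[a, b]` (`0 < a ≤ b ≤ ρ`). [folklore] -/
theorem integral_eq_integral_middle {h : ℝ → ℝ} {a b ρ : ℝ} (ha : 0 < a) (hab : a ≤ b) (hbρ : b ≤ ρ)
    (hc : ContinuousOn h (Ioi 0)) (h1 : ∀ r : ℝ, r ≤ a → h r = 0) (h2 : ∀ r : ℝ, b ≤ r → h r = 0) :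
    ∫ r in (0:ℝ)..ρ, h r = ∫ r in a..b, h r := by
  have hi : ∀ s t : ℝ, 0 < s → s ≤ t → IntervalIntegrable h volume s t := fun s t hs hst =>
    (hc.mono fun r hr => lt_of_lt_of_le hs hr.1).intervalIntegrable_of_Icc hst
  have hz1 : ∫ r in (0:ℝ)..a, h r = 0 := by
    rw [intervalIntegral.integral_congr (g := fun _ => (0:ℝ)) fun r hr => ?_, intervalIntegral.integral_zero]
    rw [uIcc_of_le ha.le] at hr; exact h1 r hr.2
  have hz2 : ∫ r in b..ρ, h r = 0 := by
    rw [intervalIntegral.integral_congr (g := fun _ => (0:ℝ)) fun r hr => ?_, intervalIntegral.integral_zero]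
    rw [uIcc_of_le hbρ] at hr; exact h2 r hr.1
  have hi0 : IntervalIntegrable h volume 0 a := by
    refine (intervalIntegrable_iff_integrableOn_Ioc_of_le ha.le).2 ?_
    refine (integrableOn_zero).congr_fun (fun r hr => (h1 r hr.2).symm) measurableSet_Ioc
  rw [← intervalIntegral.integral_add_adjacent_intervals ((hi0.trans (hi a b ha hab))) (hi b ρ (lt_of_lt_of_le ha hab) hbρ),
    ← intervalIntegral.integral_add_adjacent_intervals hi0 (hi a b ha hab), hz1, hz2, zero_add, add_zero]

/-- ★★ **THE `L²` MASS OF THE PROFILE**: `∫₀^ρ F(r)² dr = L·∫_{−2}^{−1} Ψ²` for `e^{c−L} ≤ ρ`. [cite: SchoenUhlenbeck1984, Lemma 1.3] -/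
theorem integral_logProfile_sq (hΨ : ContDiff ℝ ∞ Ψ) (hΨ0 : ∀ u : ℝ, u ≤ -2 ∨ -1 ≤ u → Ψ u = 0) (hL : 0 < L)
    {ρ : ℝ} (hρ : Real.exp (c - L) ≤ ρ) :
    ∫ r in (0:ℝ)..ρ, (Ψ ((Real.log r - c) / L) * (Real.sqrt r)⁻¹) ^ 2 = L * ∫ u in (-2:ℝ)..(-1), Ψ u ^ 2 := by
  have hab : Real.exp (c - 2 * L) ≤ Real.exp (c - L) := Real.exp_le_exp.2 (by linarith)
  -- on `(0, ∞)` the square is `r⁻¹·Ψ(φ)²`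
  have hsq : ∀ r : ℝ, 0 < r → (Ψ ((Real.log r - c) / L) * (Real.sqrt r)⁻¹) ^ 2 = r⁻¹ * (fun u => Ψ u ^ 2) ((Real.log r - c) / L) := by
    intro r hr
    rw [mul_pow, inv_pow, Real.sq_sqrt hr.le]; ring
  rw [integral_eq_integral_middle (Real.exp_pos _) hab hρ ?_ ?_ ?_]
  · rw [intervalIntegral.integral_congr (g := fun r => r⁻¹ * (fun u => Ψ u ^ 2) ((Real.log r - c) / L)) fun r hr => ?_]
    · exact integral_inv_mul_comp_log hL (hΨ.continuous.pow 2)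
    · rw [uIcc_of_le hab] at hr
      exact hsq r (lt_of_lt_of_le (Real.exp_pos _) hr.1)
  · intro r hr
    exact (((contDiffAt_logProfile hΨ c L (mem_Ioi.1 hr)).continuousAt).pow 2).continuousWithinAt
  · intro r hr; rw [logProfile_eq_zero_of_le hΨ0 hL hr]; ring
  · intro r hr; rw [logProfile_eq_zero_of_ge hΨ0 hL hr]; ring

/-- ★★ **THE WEIGHTED DIRICHLET MASS OF THE PROFILE**: `∫₀^ρ r²·F′(r)² dr = L·∫_{−2}^{−1} (Ψ′∕L − Ψ∕2)²` for `e^{c−L} ≤ ρ`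
(`Ψ′` vanishing off `(−2,−1)` as well). [cite: SchoenUhlenbeck1984, Lemma 1.3] -/
theorem integral_sq_mul_deriv_logProfile_sq (hΨ : ContDiff ℝ ∞ Ψ) (hΨ0 : ∀ u : ℝ, u ≤ -2 ∨ -1 ≤ u → Ψ u = 0)
    (hΨ'0 : ∀ u : ℝ, u ≤ -2 ∨ -1 ≤ u → deriv Ψ u = 0) (hL : 0 < L) {ρ : ℝ} (hρ : Real.exp (c - L) ≤ ρ) :
    ∫ r in (0:ℝ)..ρ, r ^ 2 * deriv (fun r : ℝ => Ψ ((Real.log r - c) / L) * (Real.sqrt r)⁻¹) r ^ 2 =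
      L * ∫ u in (-2:ℝ)..(-1), (deriv Ψ u / L - Ψ u / 2) ^ 2 := by
  have hab : Real.exp (c - 2 * L) ≤ Real.exp (c - L) := Real.exp_le_exp.2 (by linarith)
  have hΨ'c : Continuous (deriv Ψ) := hΨ.continuous_deriv (by simp)
  -- on `(0, ∞)`: `r²F′² = r⁻¹·(Ψ′(φ)/L − Ψ(φ)/2)²`
  have hsq : ∀ r : ℝ, 0 < r → r ^ 2 * deriv (fun r : ℝ => Ψ ((Real.log r - c) / L) * (Real.sqrt r)⁻¹) r ^ 2 =
      r⁻¹ * (fun u => (deriv Ψ u / L - Ψ u / 2) ^ 2) ((Real.log r - c) / L) := by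
    intro r hr
    rw [(hasDerivAt_logProfile hΨ c hL.ne' hr).deriv, mul_pow, mul_pow, inv_pow, inv_pow, Real.sq_sqrt hr.le]
    field_simp
  -- the integrand vanishes near `0⁺` (hence `F′(0) = 0`) and beyond `e^{c−L}`
  have hzero_small : ∀ r : ℝ, r < Real.exp (c - 2 * L) → deriv (fun r : ℝ => Ψ ((Real.log r - c) / L) * (Real.sqrt r)⁻¹) r = 0 := by
    intro r hr
    have hev : (fun r : ℝ => Ψ ((Real.log r - c) / L) * (Real.sqrt r)⁻¹) =ᶠ[𝓝 r] fun _ => 0 := by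
      filter_upwards [Iio_mem_nhds hr] with s hs using logProfile_eq_zero_of_le hΨ0 hL hs.le
    rw [hev.deriv_eq]; exact deriv_const r 0
  rw [integral_eq_integral_middle (Real.exp_pos _) hab hρ ?_ ?_ ?_]
  · rw [intervalIntegral.integral_congr (g := fun r => r⁻¹ * (fun u => (deriv Ψ u / L - Ψ u / 2) ^ 2) ((Real.log r - c) / L))
      fun r hr => ?_]
    · exact integral_inv_mul_comp_log hL (((hΨ'c.div_const L).sub (hΨ.continuous.div_const 2)).pow 2)
    · rw [uIcc_of_le hab] at hr
      exact hsq r (lt_of_lt_of_le (Real.exp_pos _) hr.1)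
  · -- continuity on `(0, ∞)` via the closed form
    have hc' : ContinuousOn (fun r : ℝ => r⁻¹ * (fun u => (deriv Ψ u / L - Ψ u / 2) ^ 2) ((Real.log r - c) / L)) (Ioi 0) := by
      intro r hr
      have hr0 : r ≠ 0 := (mem_Ioi.1 hr).ne'
      exact ((continuousAt_inv₀ hr0).mul
        (((((hΨ'c.div_const L).sub (hΨ.continuous.div_const 2)).pow 2).continuousAt).comp
          (((Real.continuousAt_log hr0).sub continuousAt_const).div_const L))).continuousWithinAt
    exact hc'.congr fun r hr => hsq r hr
  · intro r hr
    by_cases hr' : r < Real.exp (c - 2 * L)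
    · rw [hzero_small r hr']; ring
    · have hreq : r = Real.exp (c - 2 * L) := le_antisymm hr (not_lt.1 hr')
      have hr0 : 0 < r := hreq ▸ Real.exp_pos _
      rw [hsq r hr0]
      have : (Real.log r - c) / L = -2 := by rw [hreq, Real.log_exp]; field_simp; ring
      rw [this]
      simp only [hΨ0 _ (Or.inl le_rfl), hΨ'0 _ (Or.inl le_rfl)]; ring
  · intro r hr
    have hr0 : 0 < r := lt_of_lt_of_le (Real.exp_pos _) hr
    rw [hsq r hr0]
    have hlog : c - L ≤ Real.log r := by
      rw [← Real.log_exp (c - L)]; exact Real.log_le_log (Real.exp_pos _) hr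
    have hu : -1 ≤ (Real.log r - c) / L := by rw [le_div_iff₀ hL]; linarith
    simp only [hΨ0 _ (Or.inr hu), hΨ'0 _ (Or.inr hu)]; ring

/-- ★ **THE CROSS TERM VANISHES**: `∫_{−2}^{−1} (Ψ′∕L − Ψ∕2)² = (∫_{−2}^{−1} Ψ′²)∕L² + (∫_{−2}^{−1} Ψ²)∕4`, because
`∫_{−2}^{−1} Ψ·Ψ′ = [Ψ²∕2]_{−2}^{−1} = 0`. [folklore] -/
theorem integral_profile_quadratic (hΨ : ContDiff ℝ ∞ Ψ) (hΨ0 : ∀ u : ℝ, u ≤ -2 ∨ -1 ≤ u → Ψ u = 0) (L : ℝ) :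
    ∫ u in (-2:ℝ)..(-1), (deriv Ψ u / L - Ψ u / 2) ^ 2 =
      (∫ u in (-2:ℝ)..(-1), deriv Ψ u ^ 2) / L ^ 2 + (∫ u in (-2:ℝ)..(-1), Ψ u ^ 2) / 4 := by
  have hΨd : Differentiable ℝ Ψ := hΨ.differentiable (by simp)
  have hΨ'c : Continuous (deriv Ψ) := hΨ.continuous_deriv (by simp)
  have hcross : ∫ u in (-2:ℝ)..(-1), Ψ u * deriv Ψ u = 0 := by
    have hd : ∀ u ∈ uIcc (-2:ℝ) (-1), HasDerivAt (fun u => Ψ u ^ 2 / 2) (Ψ u * deriv Ψ u) u := by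
      intro u _
      have := ((hΨd u).hasDerivAt).pow 2
      have h2 := this.div_const 2
      refine h2.congr_deriv ?_
      simp; ring
    rw [intervalIntegral.integral_eq_sub_of_hasDerivAt hd ((hΨ.continuous.mul hΨ'c).intervalIntegrable _ _),
      hΨ0 _ (Or.inr le_rfl), hΨ0 _ (Or.inl le_rfl)]
    simp
  have hexp : ∀ u : ℝ, (deriv Ψ u / L - Ψ u / 2) ^ 2 = deriv Ψ u ^ 2 / L ^ 2 - (Ψ u * deriv Ψ u) / L + Ψ u ^ 2 / 4 := by
    intro u; ring
  simp_rw [hexp]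
  have i1 : IntervalIntegrable (fun u => deriv Ψ u ^ 2 / L ^ 2) volume (-2:ℝ) (-1) := ((hΨ'c.pow 2).div_const _).intervalIntegrable _ _
  have i2 : IntervalIntegrable (fun u => Ψ u * deriv Ψ u / L) volume (-2:ℝ) (-1) := ((hΨ.continuous.mul hΨ'c).div_const _).intervalIntegrable _ _
  have i3 : IntervalIntegrable (fun u => Ψ u ^ 2 / 4) volume (-2:ℝ) (-1) := ((hΨ.continuous.pow 2).div_const _).intervalIntegrable _ _
  rw [intervalIntegral.integral_add (i1.sub i2) i3, intervalIntegral.integral_sub i1 i2,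
    intervalIntegral.integral_div, intervalIntegral.integral_div, intervalIntegral.integral_div, hcross]
  ring

end Summit.QuantumFields.YangMills.Theorems.PoincareLipschitzHardyLogProfile

end
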